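import Mathlib.Data.Nat.Log
import Literature.Barriers.Parity.SiegelZeroGoldbachPrimeSide
import HarnessLib

/-!
# Goldston–Suriajaya, Theorem 1: the classes `(b, q) > 1` (GS21 (Psi(d>1))), proved

Sibling of `Literature/Barriers/Parity/SiegelZeroPrimePairs.lean` (Goldston–Suriajaya,
arXiv:2104.09407, Theorem 1). Everything in this file is PROVED. GS21 (Sq3)–(Psi(d>1)):
"`Ψ(r; q, b) ≪ log q log N` when `(b, q) = d > 1`", because only the powers of the primes
dividing `q` occur. We prove a cruder bound that suffices for Theorem 1 (it only has to be
`o(N/√φ(q))`): for `0 ≤ ρ < 1` and any `V > 0`,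

* `nonUnitGen_le` — `Z₀ = ∑_{(b,q)>1} Ψ(ρ; q, b) ≤ ω(q) (ρ/((1 − ρ)√V) + √V)`
  (`= 2ω(q)√N` for `ρ/(1 − ρ) ≤ N = V`),

from `Z₀ = ∑_n 𝟙_{(n,q)>1} Λ(n) ρⁿ ≤ ∑_{p ∣ q} ∑_n 𝟙_{p ∣ n} Λ(n) ρⁿ`, partial summation, and
`∑_{n ≤ T, p ∣ n} Λ(n) = log p · ⌊log_p T⌋ ≤ log T ≤ 2√T ≤ T/√V + √V`.

## References

* D. A. Goldston, A. I. Suriajaya, *Note on the Goldbach conjecture and Landau–Siegel zeros*,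
  arXiv:2104.09407 (2021), §4: (Sq3), (Psi(d>1)), (sum_exp). [cite: GoldstonSuriajaya2021, §4 (Psi(d>1))]
-/

noncomputable section

open Finset Real
open scoped ArithmeticFunction.vonMangoldt

namespace Literature.Barriers.Parity

namespace GoldstonSuriajaya

open Literature.NumberTheory.Sieve

variable {ρ : ℝ}

/-! ### Prime powers of one prime up to `T` -/

/-- `∑_{n ≤ T, p ∣ n} Λ(n) ≤ log T` for a prime `p` and `T ≥ 1`: the `n` that count are the powers
`p^k ≤ T`, all dividing `p^{⌊log_p T⌋} ≤ T`, and `∑_{d ∣ m} Λ(d) = log m` (GS21 (Psi(d>1)):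
"`Λ(dm) = log p` if and only if `dm = p^j`"). [cite: GoldstonSuriajaya2021, §4 (Psi(d>1))] -/
theorem sum_range_ite_dvd_vonMangoldt_le {p : ℕ} (hp : p.Prime) {T : ℕ} (hT : T ≠ 0) :
    ∑ n ∈ range (T + 1), (if p ∣ n then Λ n else 0) ≤ Real.log T := by
  set P : ℕ := p ^ Nat.log p T with hPdef
  have hP0 : P ≠ 0 := pow_ne_zero _ hp.ne_zero
  have hPT : P ≤ T := Nat.pow_log_le_self p hT
  rw [← sum_filter]
  -- the terms with `Λ(n) ≠ 0` are powers of `p` dividing `P`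
  have hkey : ∀ n ∈ (range (T + 1)).filter (fun n => p ∣ n), Λ n ≠ 0 → n ∣ P := by
    intro n hn hΛ
    rw [mem_filter, mem_range] at hn
    obtain ⟨r, k, hr, hk, rfl⟩ := (isPrimePow_nat_iff _).mp
      (ArithmeticFunction.vonMangoldt_ne_zero_iff.mp hΛ)
    have hpr : p = r := (Nat.prime_dvd_prime_iff_eq hp hr).mp (hp.dvd_of_dvd_pow hn.2)
    subst hpr
    exact pow_dvd_pow p (Nat.le_log_of_pow_le hp.one_lt (Nat.lt_succ_iff.mp hn.1))
  rw [← sum_filter_of_ne hkey]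
  calc ∑ n ∈ ((range (T + 1)).filter (fun n => p ∣ n)).filter (fun n => n ∣ P), Λ n
      ≤ ∑ n ∈ P.divisors, Λ n := by
        refine sum_le_sum_of_subset_of_nonneg (fun n hn => ?_)
          fun n _ _ => ArithmeticFunction.vonMangoldt_nonneg
        rw [mem_filter] at hn
        exact Nat.mem_divisors.mpr ⟨hn.2, hP0⟩
    _ = Real.log P := ArithmeticFunction.vonMangoldt_sum
    _ ≤ Real.log T := Real.log_le_log (by exact_mod_cast Nat.pos_of_ne_zero hP0) (by exact_mod_cast hPT)

/-- `log T ≤ T/√V + √V` for `V > 0` (`log T ≤ 2√T` and `2√T√V ≤ T + V`). [folklore] -/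
theorem log_le_div_sqrt_add_sqrt {T V : ℝ} (hT : 0 ≤ T) (hV : 0 < V) :
    Real.log T ≤ T / Real.sqrt V + Real.sqrt V := by
  have h1 : Real.log T ≤ 2 * Real.sqrt T := by
    have h := Real.log_le_self (Real.sqrt_nonneg T)
    rw [Real.log_sqrt hT] at h
    linarith
  have hsV : 0 < Real.sqrt V := Real.sqrt_pos.mpr hV
  have h2 : 2 * Real.sqrt T * Real.sqrt V ≤ T + V := by
    nlinarith [sq_nonneg (Real.sqrt T - Real.sqrt V), Real.sq_sqrt hT, Real.sq_sqrt hV.le]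
  rw [div_add' _ _ _ hsV.ne', le_div_iff₀ hsV, ← Real.sqrt_mul_self hV.le, ← pow_two,
    Real.sqrt_sq hV.le]
  nlinarith [Real.sq_sqrt hV.le]

/-- `∑_n 𝟙_{p ∣ n} Λ(n) ρⁿ ≤ ρ/((1 − ρ)√V) + √V` for a prime `p`, `0 ≤ ρ < 1`, `V > 0`
(partial summation and the two lemmas above; GS21 (Psi(d>1)): `≤ log q ∑_j e^{−2^j/N} ≪ log q log N`).
[cite: GoldstonSuriajaya2021, §4 (Psi(d>1))] -/
theorem tsum_ite_dvd_vonMangoldt_mul_pow_le {p : ℕ} (hp : p.Prime) (hρ0 : 0 ≤ ρ) (hρ1 : ρ < 1)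
    {V : ℝ} (hV : 0 < V) :
    ∑' n : ℕ, (if p ∣ n then Λ n else 0) * ρ ^ n ≤ ρ / ((1 - ρ) * Real.sqrt V) + Real.sqrt V := by
  have h1ρ : 0 < 1 - ρ := by linarith
  have hsV : 0 < Real.sqrt V := Real.sqrt_pos.mpr hV
  set A : ℕ → ℝ := fun T => ∑ n ∈ range (T + 1), (if p ∣ n then Λ n else 0) with hAdef
  have hA0 : ∀ T, 0 ≤ A T := fun T => sum_nonneg fun n _ => by
    split_ifs
    · exact ArithmeticFunction.vonMangoldt_nonneg
    · exact le_rfl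
  -- `A(T) ≤ T²` (for summability) and `A(T) ≤ T/√V + √V`
  have hAsq : ∀ T : ℕ, A T ≤ 1 * (T : ℝ) ^ 2 := by
    intro T
    rw [one_mul]
    calc A T ≤ ∑ n ∈ range (T + 1), (n : ℝ) := by
          refine sum_le_sum fun n _ => ?_
          split_ifs
          · exact vonMangoldt_le_self n
          · exact Nat.cast_nonneg n
      _ ≤ (T : ℝ) ^ 2 := by
          have h := congrArg (Nat.cast (R := ℝ)) (sum_range_id_mul_two (T + 1))
          push_cast at h
          have hT : (T : ℝ) ≤ (T : ℝ) ^ 2 := by exact_mod_cast Nat.le_self_pow two_ne_zero T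
          nlinarith
  have hAle : ∀ T : ℕ, A T ≤ (T : ℝ) / Real.sqrt V + Real.sqrt V := by
    intro T
    rcases Nat.eq_zero_or_pos T with rfl | hT
    · simp only [hAdef, zero_add, range_one, sum_singleton, dvd_zero, if_true,
        ArithmeticFunction.map_zero, Nat.cast_zero, zero_div]
      exact hsV.le
    · exact (sum_range_ite_dvd_vonMangoldt_le hp hT.ne').trans
        (log_le_div_sqrt_add_sqrt (Nat.cast_nonneg T) hV)
  have hsA : Summable (fun T : ℕ => A T * ρ ^ T) := summable_mul_pow_of_le hρ0 hρ1 2 hA0 hAsq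
  have h1 : Summable (fun i : ℕ => (i : ℝ) * ρ ^ i) := by
    simpa using summable_pow_mul_pow hρ0 hρ1 1
  have h0 : Summable (fun i : ℕ => ρ ^ i) := summable_geometric_of_lt_one hρ0 hρ1
  have hsB : Summable (fun T : ℕ => ((T : ℝ) / Real.sqrt V + Real.sqrt V) * ρ ^ T) := by
    have : ∀ T : ℕ, ((T : ℝ) / Real.sqrt V + Real.sqrt V) * ρ ^ T =
        (1 / Real.sqrt V) * ((T : ℝ) * ρ ^ T) + Real.sqrt V * ρ ^ T := fun T => by ring
    exact ((h1.mul_left _).add (h0.mul_left _)).congr fun T => (this T).symm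
  rw [tsum_mul_pow_eq hsA]
  have hle : ∑' T : ℕ, A T * ρ ^ T ≤ ∑' T : ℕ, ((T : ℝ) / Real.sqrt V + Real.sqrt V) * ρ ^ T :=
    hsA.tsum_le_tsum (fun T => mul_le_mul_of_nonneg_right (hAle T) (pow_nonneg hρ0 T)) hsB
  have heval : ∑' T : ℕ, ((T : ℝ) / Real.sqrt V + Real.sqrt V) * ρ ^ T =
      (1 / Real.sqrt V) * (ρ / (1 - ρ) ^ 2) + Real.sqrt V * (1 / (1 - ρ)) := by
    have : ∀ T : ℕ, ((T : ℝ) / Real.sqrt V + Real.sqrt V) * ρ ^ T =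
        (1 / Real.sqrt V) * ((T : ℝ) * ρ ^ T) + Real.sqrt V * ρ ^ T := fun T => by ring
    rw [tsum_congr this, (h1.mul_left _).tsum_add (h0.mul_left _), tsum_mul_left, tsum_mul_left,
      tsum_nat_mul_pow_eq hρ0 hρ1, tsum_pow_eq hρ0 hρ1]
  rw [heval] at hle
  calc (1 - ρ) * ∑' T : ℕ, A T * ρ ^ T
      ≤ (1 - ρ) * ((1 / Real.sqrt V) * (ρ / (1 - ρ) ^ 2) + Real.sqrt V * (1 / (1 - ρ))) :=
        mul_le_mul_of_nonneg_left hle h1ρ.le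
    _ = ρ / ((1 - ρ) * Real.sqrt V) + Real.sqrt V := by
        field_simp

/-! ### `Z₀` as a single series and its bound -/

/-- `Z₀ = ∑_n 𝟙_{(n, q) > 1} Λ(n) ρⁿ` for `0 ≤ ρ < 1`. [cite: GoldstonSuriajaya2021, §4 (Psi(d>1))] -/
theorem nonUnitGen_eq_tsum (q : ℕ) [NeZero q] (hρ0 : 0 ≤ ρ) (hρ1 : ρ < 1) :
    nonUnitGen q ρ = ∑' n : ℕ, (if IsUnit (n : ZMod q) then 0 else Λ n) * ρ ^ n := by
  unfold nonUnitGen psiGen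
  rw [← Summable.tsum_finsetSum (fun b _ => (summable_norm_residueClass_mul_pow q b hρ0 hρ1).of_norm)]
  refine tsum_congr fun n => ?_
  rw [← sum_mul]
  congr 1
  have hind : ∀ b : ZMod q, ArithmeticFunction.vonMangoldt.residueClass b n =
      if (n : ZMod q) = b then Λ n else 0 := by
    intro b
    simp only [ArithmeticFunction.vonMangoldt.residueClass, Set.indicator_apply, Set.mem_setOf_eq]
  simp_rw [hind]
  rw [sum_ite_eq]
  simp only [mem_filter, mem_univ, true_and]
  split_ifs <;> rfl

/-- Pointwise: `𝟙_{(n, q) > 1} Λ(n) ≤ ∑_{p ∣ q} 𝟙_{p ∣ n} Λ(n)`. [folklore] -/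
theorem ite_not_isUnit_le_sum_primeFactors (q : ℕ) [NeZero q] (n : ℕ) :
    (if IsUnit (n : ZMod q) then 0 else Λ n) ≤ ∑ p ∈ q.primeFactors, (if p ∣ n then Λ n else 0) := by
  have h0 : ∀ p ∈ q.primeFactors, 0 ≤ (if p ∣ n then Λ n else 0 : ℝ) := fun p _ => by
    split_ifs
    · exact ArithmeticFunction.vonMangoldt_nonneg
    · exact le_rfl
  split_ifs with hu
  · exact sum_nonneg h0
  · rw [ZMod.isUnit_iff_coprime] at hu
    obtain ⟨p, hp, hpn, hpq⟩ := Nat.Prime.not_coprime_iff_dvd.mp hu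
    have hmem : p ∈ q.primeFactors := Nat.mem_primeFactors.mpr ⟨hp, hpq, NeZero.ne q⟩
    refine le_trans ?_ (single_le_sum h0 hmem)
    rw [if_pos hpn]

/-- **GS21 (Psi(d>1)), crude form.** For `0 ≤ ρ < 1` and `V > 0`,
`Z₀ = ∑_{(b, q) > 1} Ψ(ρ; q, b) ≤ ω(q)(ρ/((1 − ρ)√V) + √V)`, `ω(q)` the number of prime factors of
`q` (the source has `Ψ(r; q, b) ≪ log q log N` for each such class).
[cite: GoldstonSuriajaya2021, §4 (Psi(d>1))] -/
theorem nonUnitGen_le (q : ℕ) [NeZero q] (hρ0 : 0 ≤ ρ) (hρ1 : ρ < 1) {V : ℝ} (hV : 0 < V) :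
    nonUnitGen q ρ ≤ (q.primeFactors.card : ℝ) * (ρ / ((1 - ρ) * Real.sqrt V) + Real.sqrt V) := by
  rw [nonUnitGen_eq_tsum q hρ0 hρ1]
  have hsp : ∀ p ∈ q.primeFactors, Summable (fun n : ℕ => (if p ∣ n then Λ n else 0) * ρ ^ n) := by
    intro p _
    refine summable_mul_pow_of_le hρ0 hρ1 1 (C := 1) (fun n => ?_) fun n => ?_
    · split_ifs
      · exact ArithmeticFunction.vonMangoldt_nonneg
      · exact le_rfl
    · rw [one_mul, pow_one]
      split_ifs
      · exact vonMangoldt_le_self n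
      · exact Nat.cast_nonneg n
  have hsg : Summable (fun n : ℕ => (if IsUnit (n : ZMod q) then 0 else Λ n) * ρ ^ n) := by
    refine summable_mul_pow_of_le hρ0 hρ1 1 (C := 1) (fun n => ?_) fun n => ?_
    · split_ifs
      · exact le_rfl
      · exact ArithmeticFunction.vonMangoldt_nonneg
    · rw [one_mul, pow_one]
      split_ifs
      · exact Nat.cast_nonneg n
      · exact vonMangoldt_le_self n
  have hsum : Summable (fun n : ℕ => (∑ p ∈ q.primeFactors, (if p ∣ n then Λ n else 0)) * ρ ^ n) := by
    have := summable_sum (s := q.primeFactors) hsp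
    refine this.congr fun n => ?_
    rw [sum_mul]
  calc ∑' n : ℕ, (if IsUnit (n : ZMod q) then 0 else Λ n) * ρ ^ n
      ≤ ∑' n : ℕ, (∑ p ∈ q.primeFactors, (if p ∣ n then Λ n else 0)) * ρ ^ n :=
        hsg.tsum_le_tsum (fun n => mul_le_mul_of_nonneg_right
          (ite_not_isUnit_le_sum_primeFactors q n) (pow_nonneg hρ0 n)) hsum
    _ = ∑ p ∈ q.primeFactors, ∑' n : ℕ, (if p ∣ n then Λ n else 0) * ρ ^ n := by
        rw [← Summable.tsum_finsetSum hsp]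
        exact tsum_congr fun n => by rw [sum_mul]
    _ ≤ ∑ _p ∈ q.primeFactors, (ρ / ((1 - ρ) * Real.sqrt V) + Real.sqrt V) :=
        sum_le_sum fun p hp => tsum_ite_dvd_vonMangoldt_mul_pow_le
          (Nat.prime_of_mem_primeFactors hp) hρ0 hρ1 hV
    _ = (q.primeFactors.card : ℝ) * (ρ / ((1 - ρ) * Real.sqrt V) + Real.sqrt V) := by
        rw [sum_const, nsmul_eq_mul]

end GoldstonSuriajaya

end Literature.Barriers.Parity
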